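import Mathlib.Analysis.InnerProductSpace.Adjoint
import Mathlib.Analysis.InnerProductSpace.Calculus
import Mathlib.Geometry.Euclidean.Inversion.Calculus
import Mathlib.LinearAlgebra.FiniteDimensional.Basic
import Literature.Analysis.FluidPDE.OnsagerBDSVStationaryPhase
import HarnessLib

/-!
# BDSV stationary phase, I: the geometry of the phase gradient

Buckmaster–De Lellis–Székelyhidi–Vicol, *Onsager's conjecture for admissible weak solutions*,
CPAM 72 (2019), App. C, Prop. C.2, estimate (C.1), is proved (following the detailed proof the
authors point to, Daneri–Székelyhidi 2017, Lemma 2.2 (i)) by `N` integrations by parts along the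
vector field `∇φ/|∇φ|²`, `φ = k·Φ` the phase. This file sets up the pointwise geometry of that
vector field for the tree's transcription of Prop. C.2 (`OnsagerBDSVStationaryPhase.lean`:
phase `2π m·Φ`, `Φ = id + D`, `D` a periodic displacement on `T³ = (ℝ/ℤ)³`,
non-degeneracy `BDSV.IsNondegenerateDisplacement Ĉ D`):

* the frequency vector is the tree's `Torus.latticeVec m ∈ ℝ³`; `BDSV.unitFreq m = m/|m|`;
* `BDSV.adjApply w T = ∑ⱼ ⟪w, T eⱼ⟫ eⱼ = Tᵀ w` (`= ContinuousLinearMap.adjoint T w`,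
  `BDSV.adjApply_eq_adjoint`; kept as an honest `ℝ`-linear map of `T` for the calculus) and the
  **direction field**
  `BDSV.dirVec m D x = (Id + ∇D(x))ᵀ (m/|m|) = ∇(m·Φ)(x)/|m|`, with
  `⟪dirVec, v⟫ = ⟪m/|m|, v + ∇D(x) v⟫` and the two-sided bound `Ĉ⁻¹ ≤ |dirVec| ≤ Ĉ` under
  non-degeneracy (the lower bound uses that the injective map `Id + ∇D(x)` of `ℝ³` is onto);
* `BDSV.recipVec v = v/|v|²`, which is Mathlib's inversion in the unit sphere
  (`BDSV.recipVec_eq_inversion`, whence smoothness off the origin and `|v/|v|²| = |v|⁻¹`), and the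
  **integration-by-parts field**
  `BDSV.ibpField m D j = (2π|m|)⁻¹ (dirVec/|dirVec|²)ⱼ = (∇φ/|∇φ|²)ⱼ`, `φ = 2π m·Φ`, with the
  key identity `∑ⱼ ibpField ⱼ · (2π|m| dirVecⱼ) = 1` and its smoothness.

Everything here is elementary linear algebra and calculus ([folklore]); the analytic content of
Prop. C.2 is in the sequel files (`…StationaryPhaseIBP.lean`, `…StationaryPhaseProofs.lean`).

## References

* T. Buckmaster, C. De Lellis, L. Székelyhidi Jr., V. Vicol, *Onsager's conjecture for admissible
  weak solutions*, CPAM 72 (2019) = arXiv:1701.08678, App. C, Prop. C.2. [`BuckmasterEtAl2018`]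
* S. Daneri, L. Székelyhidi Jr., *Non-uniqueness and h-principle for Hölder-continuous weak
  solutions of the Euler equations*, ARMA 224 (2017) = arXiv:1603.09714, Lemma 2.2 and its proof.
  [`DaneriSzekelyhidi2017`]
-/

noncomputable section

open Set
open scoped NNReal ENNReal ContDiff InnerProductSpace

namespace Literature.Analysis.FluidPDE

namespace BDSV

open FunctionSpaces FunctionSpaces.Torus

/-- The flat three-torus `T³ = (ℝ/ℤ)³`, local notation. -/
local notation "𝕋³" => UnitAddTorus (Fin 3)

/-- Euclidean `ℝ³`, local notation. -/
local notation "ℝ³" => EuclideanSpace ℝ (Fin 3)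

/-! ## Frequency vectors -/

section Freq

/-- `|m| = (∑ mⱼ²)^{1/2} = √(freqNormSq m)` for the lattice vector `latticeVec m ∈ ℝ³` of a frequency
`m ∈ ℤ³` (`Torus.latticeVec`, `Torus.freqNormSq`). [folklore] -/
theorem norm_latticeVec_eq_sqrt (m : Fin 3 → ℤ) : ‖latticeVec m‖ = Real.sqrt (freqNormSq m) := by
  rw [EuclideanSpace.norm_eq, freqNormSq]
  congr 1
  refine Finset.sum_congr rfl fun j _ => ?_
  simp [Real.norm_eq_abs, sq_abs]

/-- `|m| ≥ 1` for `m ≠ 0`. [folklore] -/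
theorem one_le_norm_latticeVec {m : Fin 3 → ℤ} (hm : m ≠ 0) : 1 ≤ ‖latticeVec m‖ := by
  rw [norm_latticeVec_eq_sqrt]; exact one_le_sqrt_freqNormSq hm

/-- `|m| > 0` for `m ≠ 0`. [folklore] -/
theorem norm_latticeVec_pos {m : Fin 3 → ℤ} (hm : m ≠ 0) : 0 < ‖latticeVec m‖ :=
  lt_of_lt_of_le one_pos (one_le_norm_latticeVec hm)

/-- The unit frequency vector `m/|m|` (`= 0` for `m = 0`). [folklore] -/
def unitFreq (m : Fin 3 → ℤ) : ℝ³ := ‖latticeVec m‖⁻¹ • latticeVec m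

/-- `|m/|m|| = 1` for `m ≠ 0`. [folklore] -/
theorem norm_unitFreq {m : Fin 3 → ℤ} (hm : m ≠ 0) : ‖unitFreq m‖ = 1 := by
  rw [unitFreq, norm_smul, norm_inv, norm_norm, inv_mul_cancel₀ (norm_latticeVec_pos hm).ne']

/-- `|m| (m/|m|) = m`. [folklore] -/
theorem norm_smul_unitFreq (m : Fin 3 → ℤ) : ‖latticeVec m‖ • unitFreq m = latticeVec m := by
  rcases eq_or_ne (latticeVec m) 0 with h | h
  · simp [unitFreq, h]
  · rw [unitFreq, smul_smul, mul_inv_cancel₀ (norm_ne_zero_iff.2 h), one_smul]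

/-- `⟪m, v⟫ = |m| ⟪m/|m|, v⟫`. [folklore] -/
theorem inner_latticeVec_eq (m : Fin 3 → ℤ) (v : ℝ³) :
    ⟪latticeVec m, v⟫_ℝ = ‖latticeVec m‖ * ⟪unitFreq m, v⟫_ℝ := by
  rw [← real_inner_smul_left, norm_smul_unitFreq]

/-- `⟪m, v⟫ = ∑ⱼ mⱼ vⱼ`. [folklore] -/
theorem inner_latticeVec_eq_sum (m : Fin 3 → ℤ) (v : ℝ³) :
    ⟪latticeVec m, v⟫_ℝ = ∑ j, (m j : ℝ) * v j := by
  simp [PiLp.inner_apply, mul_comm]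

/-- The periodic part of the phase is `2π ⟪m, D x⟫`. [folklore] -/
theorem phaseArg_eq_inner (m : Fin 3 → ℤ) (D : 𝕋³ → ℝ³) (x : 𝕋³) :
    phaseArg m D x = 2 * Real.pi * ⟪latticeVec m, D x⟫_ℝ := by
  rw [phaseArg, inner_latticeVec_eq_sum]

end Freq

/-! ## The transpose applied to a vector, and the direction field -/

section Dir

/-- `Tᵀ w = ∑ⱼ ⟪w, T eⱼ⟫ eⱼ` as a continuous linear function of `T ∈ L(ℝ³)` (for fixed `w`).
[folklore] -/
def adjApply (w : ℝ³) : (ℝ³ →L[ℝ] ℝ³) →L[ℝ] ℝ³ :=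
  ∑ j : Fin 3, ((innerSL ℝ w).comp
    (ContinuousLinearMap.apply ℝ ℝ³ (EuclideanSpace.single j (1 : ℝ)))).smulRight
      (EuclideanSpace.single j (1 : ℝ))

/-- `adjApply w T = ∑ⱼ ⟪w, T eⱼ⟫ eⱼ`. [folklore] -/
theorem adjApply_apply (w : ℝ³) (T : ℝ³ →L[ℝ] ℝ³) :
    adjApply w T = ∑ j : Fin 3, ⟪w, T (EuclideanSpace.single j (1 : ℝ))⟫_ℝ •
      EuclideanSpace.single j (1 : ℝ) := by
  simp [adjApply]

/-- The defining property of the transpose: `⟪Tᵀ w, v⟫ = ⟪w, T v⟫`. [folklore] -/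
theorem inner_adjApply (w : ℝ³) (T : ℝ³ →L[ℝ] ℝ³) (v : ℝ³) :
    ⟪adjApply w T, v⟫_ℝ = ⟪w, T v⟫_ℝ := by
  rw [adjApply_apply, sum_inner]
  conv_rhs => rw [← (EuclideanSpace.basisFun (Fin 3) ℝ).sum_repr v]
  simp only [map_sum, map_smul, inner_sum, real_inner_smul_left, real_inner_smul_right,
    EuclideanSpace.basisFun_apply, EuclideanSpace.basisFun_repr, EuclideanSpace.inner_single_left,
    map_one, one_mul]
  refine Finset.sum_congr rfl fun j _ => ?_
  ring

/-- `adjApply w T` is Mathlib's adjoint applied to `w`: `∑ⱼ ⟪w, T eⱼ⟫ eⱼ = T† w`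
(both are characterised by `⟪·, v⟫ = ⟪w, T v⟫`). [folklore] -/
@[simp] theorem adjApply_eq_adjoint (w : ℝ³) (T : ℝ³ →L[ℝ] ℝ³) :
    adjApply w T = ContinuousLinearMap.adjoint T w :=
  ext_inner_right ℝ fun v => by rw [inner_adjApply, ContinuousLinearMap.adjoint_inner_left]

/-- `|Tᵀ w| ≤ ‖T‖ |w|` (`‖T†‖ = ‖T‖`). [folklore] -/
theorem norm_adjApply_le (w : ℝ³) (T : ℝ³ →L[ℝ] ℝ³) : ‖adjApply w T‖ ≤ ‖T‖ * ‖w‖ := by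
  rw [adjApply_eq_adjoint]
  refine ((ContinuousLinearMap.adjoint T).le_opNorm w).trans (le_of_eq ?_)
  rw [LinearIsometryEquiv.norm_map]

/-- The operator norm of `T ↦ Tᵀ w` is at most `|w|`. [folklore] -/
theorem opNorm_adjApply_le (w : ℝ³) : ‖adjApply w‖ ≤ ‖w‖ :=
  ContinuousLinearMap.opNorm_le_bound _ (norm_nonneg _) fun T => by
    rw [mul_comm]; exact norm_adjApply_le w T

/-- **The direction field** `(Id + ∇D(x))ᵀ (m/|m|) = ∇(m·Φ)(x)/|m|`, `Φ = id + D`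
(`Torus.fderiv D x = ∇D(x)`): the normalised gradient of the phase, along which Prop. C.2
integrates by parts. [folklore] -/
def dirVec (m : Fin 3 → ℤ) (D : 𝕋³ → ℝ³) (x : 𝕋³) : ℝ³ :=
  unitFreq m + adjApply (unitFreq m) (Torus.fderiv D x)

/-- `⟪dirVec, v⟫ = ⟪m/|m|, v + ∇D(x) v⟫`. [folklore] -/
theorem inner_dirVec (m : Fin 3 → ℤ) (D : 𝕋³ → ℝ³) (x : 𝕋³) (v : ℝ³) :
    ⟪dirVec m D x, v⟫_ℝ = ⟪unitFreq m, v + Torus.fderiv D x v⟫_ℝ := by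
  rw [dirVec, inner_add_left, inner_adjApply, inner_add_right]

/-- `|m| ⟪dirVec, v⟫ = ⟪m, v + ∇D(x) v⟫ = ∂ᵥ(m·Φ)(x)`. [folklore] -/
theorem norm_mul_inner_dirVec (m : Fin 3 → ℤ) (D : 𝕋³ → ℝ³) (x : 𝕋³) (v : ℝ³) :
    ‖latticeVec m‖ * ⟪dirVec m D x, v⟫_ℝ = ⟪latticeVec m, v + Torus.fderiv D x v⟫_ℝ := by
  rw [inner_dirVec, ← inner_latticeVec_eq]

variable {Ĉ : ℝ} {D : 𝕋³ → ℝ³} {m : Fin 3 → ℤ}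

/-- Under non-degeneracy the deformation `v ↦ v + ∇D(x) v` is onto (it is an injective linear
endomorphism of `ℝ³`). [folklore] -/
theorem surjective_deformation (hĈ : 1 ≤ Ĉ) (hND : IsNondegenerateDisplacement Ĉ D) (x : 𝕋³) :
    Function.Surjective fun v : ℝ³ => v + Torus.fderiv D x v := by
  set A : ℝ³ →ₗ[ℝ] ℝ³ := LinearMap.id + (Torus.fderiv D x : ℝ³ →ₗ[ℝ] ℝ³) with hA
  have hAv : ∀ v, A v = v + Torus.fderiv D x v := fun v => rfl
  have hinj : Function.Injective A := by
    intro v w hvw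
    have h0 : A (v - w) = 0 := by rw [map_sub, hvw, sub_self]
    have h1 := (hND x (v - w)).1
    rw [← hAv, h0, norm_zero] at h1
    have hC : 0 < Ĉ⁻¹ := inv_pos.2 (lt_of_lt_of_le one_pos hĈ)
    have h2 : ‖v - w‖ ≤ 0 := by
      by_contra h
      have h' : 0 < ‖v - w‖ := lt_of_not_ge h
      linarith [mul_pos hC h']
    exact sub_eq_zero.1 (norm_le_zero_iff.1 h2)
  have hsurj : Function.Surjective A := LinearMap.injective_iff_surjective.1 hinj
  intro w
  obtain ⟨v, hv⟩ := hsurj w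
  refine ⟨v, ?_⟩
  show v + Torus.fderiv D x v = w
  rw [← hAv]; exact hv

/-- **Upper bound** `|dirVec| ≤ Ĉ` under non-degeneracy: `|u|² = ⟪m̂, (Id+∇D)u⟫ ≤ Ĉ|u|`.
[folklore] -/
theorem norm_dirVec_le (hND : IsNondegenerateDisplacement Ĉ D) (hm : m ≠ 0) (x : 𝕋³) :
    ‖dirVec m D x‖ ≤ Ĉ := by
  set u := dirVec m D x with hu
  have h1 : ‖u‖ ^ 2 ≤ Ĉ * ‖u‖ := by
    calc ‖u‖ ^ 2 = ⟪u, u⟫_ℝ := (real_inner_self_eq_norm_sq u).symm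
      _ = ⟪unitFreq m, u + Torus.fderiv D x u⟫_ℝ := inner_dirVec m D x u
      _ ≤ ‖unitFreq m‖ * ‖u + Torus.fderiv D x u‖ := real_inner_le_norm _ _
      _ ≤ 1 * (Ĉ * ‖u‖) := by
          rw [norm_unitFreq hm]
          exact mul_le_mul_of_nonneg_left (hND x u).2 zero_le_one
      _ = Ĉ * ‖u‖ := one_mul _
  rcases (norm_nonneg u).eq_or_lt with h0 | hpos
  · -- `u = 0`: `0 ≤ Ĉ` follows from the upper bound at the unit vector `m/|m|`
    rw [← h0]
    have h2 := (hND x (unitFreq m)).2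
    rw [norm_unitFreq hm, mul_one] at h2
    exact le_trans (norm_nonneg _) h2
  · exact le_of_mul_le_mul_right (by rw [← sq]; exact h1) hpos

/-- **Lower bound** `Ĉ⁻¹ ≤ |dirVec|` under non-degeneracy (`Ĉ ≥ 1`): with `(Id+∇D)v = m̂`,
`1 = ⟪m̂, (Id+∇D)v⟫ = ⟪u, v⟫ ≤ |u||v| ≤ |u| Ĉ |m̂|`. [folklore] -/
theorem inv_le_norm_dirVec (hĈ : 1 ≤ Ĉ) (hND : IsNondegenerateDisplacement Ĉ D) (hm : m ≠ 0)
    (x : 𝕋³) : Ĉ⁻¹ ≤ ‖dirVec m D x‖ := by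
  have hC : 0 < Ĉ := lt_of_lt_of_le one_pos hĈ
  set u := dirVec m D x with hu
  obtain ⟨v, hv⟩ := surjective_deformation hĈ hND x (unitFreq m)
  have h1 : (1 : ℝ) ≤ ‖u‖ * (Ĉ * 1) := by
    calc (1 : ℝ) = ‖unitFreq m‖ ^ 2 := by rw [norm_unitFreq hm, one_pow]
      _ = ⟪unitFreq m, unitFreq m⟫_ℝ := (real_inner_self_eq_norm_sq _).symm
      _ = ⟪u, v⟫_ℝ := by rw [hu, inner_dirVec]; exact congrArg _ hv.symm
      _ ≤ ‖u‖ * ‖v‖ := real_inner_le_norm _ _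
      _ ≤ ‖u‖ * (Ĉ * ‖v + Torus.fderiv D x v‖) := by
          refine mul_le_mul_of_nonneg_left ?_ (norm_nonneg _)
          have := (hND x v).1
          rwa [inv_mul_le_iff₀ hC] at this
      _ = ‖u‖ * (Ĉ * 1) := by
          have hv' : v + Torus.fderiv D x v = unitFreq m := hv
          rw [hv', norm_unitFreq hm]
  rw [mul_one] at h1
  rw [inv_le_iff_one_le_mul₀ hC]
  linarith [mul_comm ‖u‖ Ĉ]

/-- Under non-degeneracy the direction field does not vanish. [folklore] -/
theorem dirVec_ne_zero (hĈ : 1 ≤ Ĉ) (hND : IsNondegenerateDisplacement Ĉ D) (hm : m ≠ 0)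
    (x : 𝕋³) : dirVec m D x ≠ 0 := by
  intro h
  have := inv_le_norm_dirVec hĈ hND hm x
  rw [h, norm_zero] at this
  exact absurd this (not_le.2 (inv_pos.2 (lt_of_lt_of_le one_pos hĈ)))

/-- `‖∇D(x)‖ ≤ Ĉ + 1` under non-degeneracy (`∇D = (Id + ∇D) - Id`). [folklore] -/
theorem norm_fderiv_le_of_isNondegenerate (hND : IsNondegenerateDisplacement Ĉ D) (x : 𝕋³) :
    ‖Torus.fderiv D x‖ ≤ Ĉ + 1 := by
  have hC0 : 0 ≤ Ĉ + 1 := by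
    -- `0 ≤ Ĉ` from the upper bound at a unit vector
    have h3 := (hND x (EuclideanSpace.single 0 (1 : ℝ))).2
    rw [PiLp.norm_single, norm_one, mul_one] at h3
    linarith [norm_nonneg (EuclideanSpace.single (0 : Fin 3) (1 : ℝ) +
      Torus.fderiv D x (EuclideanSpace.single 0 (1 : ℝ)))]
  refine ContinuousLinearMap.opNorm_le_bound _ hC0 fun v => ?_
  calc ‖Torus.fderiv D x v‖ = ‖(v + Torus.fderiv D x v) - v‖ := by rw [add_sub_cancel_left]
    _ ≤ ‖v + Torus.fderiv D x v‖ + ‖v‖ := norm_sub_le _ _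
    _ ≤ Ĉ * ‖v‖ + ‖v‖ := add_le_add (hND x v).2 le_rfl
    _ = (Ĉ + 1) * ‖v‖ := by ring

/-- The direction field of a smooth displacement is smooth; its lift is
`y ↦ m̂ + (∇D̃(y))ᵀ m̂` with `D̃ = lift D`. [folklore] -/
theorem lift_dirVec (m : Fin 3 → ℤ) (D : 𝕋³ → ℝ³) :
    lift (dirVec m D) = fun y => unitFreq m + adjApply (unitFreq m) (fderiv ℝ (lift D) y) := by
  funext y
  rw [lift_apply, dirVec, fderiv_lift]

/-- The direction field of a smooth displacement is smooth. [folklore] -/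
theorem isSmooth_dirVec (m : Fin 3 → ℤ) (hD : IsSmooth D) : IsSmooth (dirVec m D) := by
  unfold IsSmooth
  rw [lift_dirVec]
  exact contDiff_const.add ((adjApply (unitFreq m)).contDiff.comp (hD.fderiv_right le_rfl))

end Dir

/-! ## The field `v/|v|²` and the integration-by-parts field -/

section Recip

/-- `v ↦ v/|v|²`, the map applied to the phase gradient in `∇φ/|∇φ|²` (junk value `0` at `v = 0`).
[folklore] -/
def recipVec (v : ℝ³) : ℝ³ := (‖v‖ ^ 2)⁻¹ • v

/-- `v/|v|²` is Mathlib's inversion in the unit sphere about the origin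
(`EuclideanGeometry.inversion 0 1`). [folklore] -/
theorem recipVec_eq_inversion (v : ℝ³) : recipVec v = EuclideanGeometry.inversion (0 : ℝ³) 1 v := by
  simp [recipVec, EuclideanGeometry.inversion, inv_pow]

/-- `⟪v/|v|², v⟫ = 1` for `v ≠ 0`. [folklore] -/
theorem inner_recipVec_self {v : ℝ³} (hv : v ≠ 0) : ⟪recipVec v, v⟫_ℝ = 1 := by
  rw [recipVec, real_inner_smul_left, real_inner_self_eq_norm_sq,
    inv_mul_cancel₀ (pow_ne_zero 2 (norm_ne_zero_iff.2 hv))]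

/-- `|v/|v|²| = |v|⁻¹` (Mathlib `EuclideanGeometry.dist_inversion_center`). [folklore] -/
theorem norm_recipVec (v : ℝ³) : ‖recipVec v‖ = ‖v‖⁻¹ := by
  rw [recipVec_eq_inversion, ← dist_zero_right, EuclideanGeometry.dist_inversion_center,
    dist_zero_right, one_pow, one_div]

/-- `v ↦ v/|v|²` is smooth off the origin (Mathlib `ContDiffOn.inversion`). [folklore] -/
theorem contDiffOn_recipVec : ContDiffOn ℝ ∞ recipVec {v : ℝ³ | v ≠ 0} := by
  have h : ContDiffOn ℝ ∞ (fun v : ℝ³ => EuclideanGeometry.inversion (0 : ℝ³) 1 v) {v : ℝ³ | v ≠ 0} :=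
    contDiffOn_const.inversion contDiffOn_const contDiffOn_id fun v hv => hv
  refine h.congr fun v _ => ?_
  exact recipVec_eq_inversion v

variable {Ĉ : ℝ} {D : 𝕋³ → ℝ³} {m : Fin 3 → ℤ}

/-- **The integration-by-parts field** `F = ∇φ/|∇φ|²` of Prop. C.2 for the phase
`φ = 2π m·Φ`, `Φ = id + D`, by components: `∇φ = 2π|m| dirVec`, so
`Fⱼ = (2π|m|)⁻¹ (dirVec/|dirVec|²)ⱼ`. [cite: DaneriSzekelyhidi2017, Lemma 2.2 (proof)] -/
def ibpField (m : Fin 3 → ℤ) (D : 𝕋³ → ℝ³) (j : Fin 3) (x : 𝕋³) : ℝ :=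
  (2 * Real.pi * ‖latticeVec m‖)⁻¹ * recipVec (dirVec m D x) j

/-- **The key identity** `F · ∇φ = 1`: `∑ⱼ Fⱼ (2π|m| dirVecⱼ) = 1` wherever `dirVec ≠ 0`
(`m ≠ 0`). [folklore] -/
theorem sum_ibpField_mul (hm : m ≠ 0) {x : 𝕋³} (hx : dirVec m D x ≠ 0) :
    ∑ j, ibpField m D j x * (2 * Real.pi * ‖latticeVec m‖ * dirVec m D x j) = 1 := by
  have hc : (2 * Real.pi * ‖latticeVec m‖) ≠ 0 :=
    mul_ne_zero (mul_ne_zero two_ne_zero Real.pi_ne_zero) (norm_latticeVec_pos hm).ne'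
  have h1 : ∑ j, recipVec (dirVec m D x) j * dirVec m D x j = 1 := by
    have := inner_recipVec_self hx
    simpa [PiLp.inner_apply, mul_comm] using this
  calc ∑ j, ibpField m D j x * (2 * Real.pi * ‖latticeVec m‖ * dirVec m D x j)
      = ∑ j, recipVec (dirVec m D x) j * dirVec m D x j := by
        refine Finset.sum_congr rfl fun j _ => ?_
        rw [ibpField, mul_mul_mul_comm, inv_mul_cancel₀ hc, one_mul]
    _ = 1 := h1

/-- Pointwise size of the field: `|Fⱼ(x)| ≤ (2π|m|)⁻¹ |dirVec(x)|⁻¹ ≤ Ĉ/(2π|m|)` under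
non-degeneracy. [folklore] -/
theorem abs_ibpField_le (hĈ : 1 ≤ Ĉ) (hND : IsNondegenerateDisplacement Ĉ D) (hm : m ≠ 0)
    (j : Fin 3) (x : 𝕋³) : |ibpField m D j x| ≤ (2 * Real.pi * ‖latticeVec m‖)⁻¹ * Ĉ := by
  have hC : 0 < Ĉ := lt_of_lt_of_le one_pos hĈ
  have hc : 0 < 2 * Real.pi * ‖latticeVec m‖ := by
    have := norm_latticeVec_pos hm; positivity
  rw [ibpField, abs_mul, abs_inv, abs_of_pos hc]
  refine mul_le_mul_of_nonneg_left ?_ (inv_nonneg.2 hc.le)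
  calc |recipVec (dirVec m D x) j| = ‖recipVec (dirVec m D x) j‖ := (Real.norm_eq_abs _).symm
    _ ≤ ‖recipVec (dirVec m D x)‖ := PiLp.norm_apply_le _ _
    _ = ‖dirVec m D x‖⁻¹ := norm_recipVec _
    _ ≤ Ĉ := by
        rw [inv_le_comm₀ (lt_of_lt_of_le (inv_pos.2 hC) (inv_le_norm_dirVec hĈ hND hm x)) hC]
        exact inv_le_norm_dirVec hĈ hND hm x

/-- The lift of the field: `lift Fⱼ = (2π|m|)⁻¹ (recipVec ∘ lift dirVec)ⱼ`. [folklore] -/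
theorem lift_ibpField (m : Fin 3 → ℤ) (D : 𝕋³ → ℝ³) (j : Fin 3) :
    lift (ibpField m D j) =
      fun y => (2 * Real.pi * ‖latticeVec m‖)⁻¹ * (recipVec ∘ lift (dirVec m D)) y j := rfl

/-- The field is smooth for a smooth non-degenerate displacement (`v ↦ v/|v|²` is smooth off the
origin and `dirVec ≠ 0`). [folklore] -/
theorem isSmooth_ibpField (hĈ : 1 ≤ Ĉ) (hD : IsSmooth D) (hND : IsNondegenerateDisplacement Ĉ D)
    (hm : m ≠ 0) (j : Fin 3) : IsSmooth (ibpField m D j) := by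
  have hcomp : ContDiff ℝ ∞ (recipVec ∘ lift (dirVec m D)) :=
    contDiffOn_recipVec.comp_contDiff (isSmooth_dirVec m hD) fun y =>
      dirVec_ne_zero hĈ hND hm (proj y)
  unfold IsSmooth
  rw [lift_ibpField]
  exact contDiff_const.mul (contDiff_euclidean.1 hcomp j)

end Recip

end BDSV

end Literature.Analysis.FluidPDE
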